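import Mathlib
import HarnessLib
import HarnessLib.Audit
import Summits.MatrixMultiplication.Statement
import Literature.Computability.QuantumComplexity.StabilizerRank
import Literature.Computability.AlgebraicComplexity.MatrixMultiplicationExponent
import Literature.Computability.AlgebraicComplexity.StabilizerTensorRank
import Literature.Computability.AlgebraicComplexity.FlatteningBound
import Literature.Computability.AlgebraicComplexity.TensorRankFactsProofs
import HarnessLib.Audit.Status.Attr

/-!
Route: StabilizerTensorRank

DORMANT since 2026-08-22T08:26:29Z (reconciler: no traction for 5.2 d (last activity statement-grounded at 2026-08-17T02:55:51Z); parked, not closed — `ledger route dormant route-MatrixMultiplication-StabilizerTensorRank --off` to react) — unstaffed, not closed; items shared with open routes are served there. `ledger route dormant <id> --off` reactivates.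

# Route StabilizerTensorRank — omega_stab = 2 — exponent two by sums of products of stabilizer
states (Clifford/stabilizer tensor rank of <2^k>)

It suffices to show X = OmegaStabTwo (card
MatrixMultiplication/MatrixMultiplication/stabilizer-bilinear-complexity: "Strassen's seven
products are stabilizer states"): the STABILIZER TENSOR RANK exponent of matrix multiplication is 2.
Read a leg w ∈ ℂ^(2^k × 2^k) of a
rank-one term as a 2k-qubit vector (row bits ++ column bits, Fin (k+k) → Bool); call a decomposition
⟨2^k,2^k,2^k⟩ = Σ_(i<r) c_i · w_i⊗u_i⊗v_i
over ℂ a STABILIZER SCHEME if all 3r legs lie in the tree's `stabilizerStates (k+k)`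
(Clifford-circuit orbit of |0^(2k)⟩, Aaronson–Gottesman),
and let χ₃(⟨2^k⟩) be the least such r, ω_stab := inf_k log₂ χ₃(⟨2^k⟩)/k (Fekete: the model is
Kronecker-closed). Always
2 ≤ ω ≤ ω_stab ≤ log₂ 7 (Strassen's 21 legs are stabilizer: Bell pairs, basis states, |−⟩|0⟩, …). X:
ω_stab = 2, i.e. for every ε > 0 some
⟨2^k⟩ (k ≥ 1) has a stabilizer scheme with at most 2^((2+ε)k) terms. X ⟺ (ω = 2) ∧ (ω_stab = ω); the
second conjunct (StabilizerSufficiency)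
is the structural content: fast matrix multiplication is a stabilizer (= symplectic-F₂, magic-free)
phenomenon.
Lean: `∀ ε : ℝ, 0 < ε → ∃ k : ℕ, 1 ≤ k ∧ ∃ r : ℕ, (r : ℝ) ≤ (2 : ℝ) ^ ((2 + ε) * k) ∧ ∃ (c : Fin r →
ℂ) (w u v : Fin r → Fin (2 ^ k) × Fin (2 ^ k) → ℂ), (∀ i, (fun x : Fin (k + k) → Bool => w i
(finFunctionFinEquiv (fun j : Fin k => finTwoEquiv.symm (x (Fin.castAdd k j))), finFunctionFinEquiv
(fun j : Fin k => finTwoEquiv.symm (x (Fin.natAdd k j))))) ∈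
Literature.Computability.QuantumComplexity.stabilizerStates (k + k) ∧ (fun x : Fin (k + k) → Bool =>
u i (finFunctionFinEquiv (fun j : Fin k => finTwoEquiv.symm (x (Fin.castAdd k j))),
finFunctionFinEquiv (fun j : Fin k => finTwoEquiv.symm (x (Fin.natAdd k j))))) ∈
Literature.Computability.QuantumComplexity.stabilizerStates (k + k) ∧ (fun x : Fin (k + k) → Bool =>
v i (finFunctionFinEquiv (fun j : Fin k => finTwoEquiv.symm (x (Fin.castAdd k j))),
finFunctionFinEquiv (fun j : Fin k => finTwoEquiv.symm (x (Fin.natAdd k j))))) ∈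
Literature.Computability.QuantumComplexity.stabilizerStates (k + k)) ∧
Literature.Computability.AlgebraicComplexity.matMulTensor ℂ (2 ^ k) (2 ^ k) (2 ^ k) = ∑ i, c i •
Literature.Computability.AlgebraicComplexity.triad (w i) (u i) (v i)`

## Assembly
DECIDING THEOREM (D-0027 §2.1; route-repair rev 1, 2026-08-15): `closes : OmegaStabTwo →
MatrixMultiplication`, PROVED inside the route
file from proved Literature only (no Theorems/ import, no named fact): given ε > 0, OmegaStabTwo
yields k ≥ 1, r ≤ 2^((2+ε)k) and a
stabilizer scheme of ⟨2^k,2^k,2^k⟩; a stabilizer scheme is in particular a rank decomposition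
(absorb c_i into w_i:
`Literature.Computability.AlgebraicComplexity.HasStabilizerScheme`, `tensorRank_le_stabTensorRank`,
`stabTensorRank_le_of_hasStabilizerScheme`, StabilizerTensorRank.lean — the landed definition
request), so R(⟨2^k⟩) ≤ r; the flattening
bound (2^k)² ≤ R(⟨2^k⟩) (`matMulTensor_sq_le_tensorRank`) forces r ≥ 1; Bläser 2013 Thm 5.9 in
interpolation form
(`Blaser2013_logb_mem_admissibleExponents`, TensorRankFactsProofs.lean) makes log_(2^k) r an
admissible exponent, hence
ω(ℂ) ≤ log_(2^k) r ≤ 2 + ε (`admissibleExponents_bddBelow`, `Real.log_rpow`); ε → 0 and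
`omega_two_le` (FlatteningBound.lean) give
ω(ℂ) = 2. The target alone decides the summit; no crux is a formal hypothesis: the cruxes are the
milestones (2, 3), the structural half
(4) and the negative calibration (5) of the target. The `Assembly` item, formerly the target INLINED
→ summit (which the glue audit read as an
unlisted hypothesis), is restated by name, `OmegaStabTwo → MatrixMultiplication`; `closes` proves
exactly it.

Rationale: WHY THIS LINE. Mechanism (card stabilizer-bilinear-complexity): identify matrix positions of a 2^k ×
2^k matrix with 2k qubits; then ⟨2,2,2⟩ and every leg
of Strassen's algorithm are stabilizer states, so Strassen recursion lives inside a DISCRETE, hugely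
symmetric sub-model of bilinear
algorithms: legs = affine F₂-subspaces with ℤ₄-valued quadratic phases (Dehaene–De Moor
arXiv:quant-ph/0304125, Van den Nest arXiv:0811.0898),
acted on by three copies of the Clifford group (|C_k| = 2^(2k²+O(k)), a unitary 3-design) inside de
Groote's isotropy group, with
"χ₃ ≤ r" a finite span-membership problem whose coefficients (relative to the unnormalised
{0,±1,±i}-valued legs) are w.l.o.g. in ℚ(i). Imported areas: quantum information / stabilizer
formalism (the tree's StabilizerRank.lean, CliffordGaussSums.lean; BravyiSmithSmolin2016,
BravyiGosset2016, PelegShpilkaVolk2022,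
LovitzSteffan2022) for both the orbit-design upper side (Grochow–Moore's group-orbit construction of
Strassen, arXiv:1612.01527 /
arXiv:1708.09398, moved from simplex frames to symplectic geometry over F₂ — their §4 asks exactly
whether t-designs with t > 2 and other
symmetric families help) and the lower side (quadratic-phase Fourier analysis, arithmetic of ℤ[i]
mod (1+i)), plus SAT/finite search at
k = 2, 3 where the 2025–26 rank-48 schemes for ⟨4,4,4⟩ (AlphaEvolve arXiv:2506.13131; rational point
arXiv:2506.13242, built from two seeds
and an order-32 2-group of isotropies) are the test objects. What no existing route does:
AsymptoticSpectrum/AsymptoticRankCW bound ω through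
spectral points of a fixed tensor, WaringApolarity through cubes of linear forms under conjugation
designs, GroupTheoreticSTPP through
group-algebra embeddings; none restricts the COEFFICIENT STRUCTURE of decompositions of ⟨2^k⟩
itself, and none offers a finite decidable
instance per k with an arithmetic lower-bound handle. Negatives index: empty at filing.

RANKED CRUXES. #0 OmegaStabTwo (target) — ω_stab = 2: for every ε > 0 there are k ≥ 1, r ≤
2^((2+ε)k) and a stabilizer scheme of ⟨2^k,2^k,2^k⟩ with r terms (coefficients c_i ∈ ℂ, legs
w_i,u_i,v_i : Fin 2^k × Fin 2^k → ℂ whose bit-reindexings lie in stabilizerStates (k+k)). Card items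
(i)+(ii). (why it might fail: ω_stab may exceed 2 even if ω = 2: every known sub-Strassen scheme at
n = 2^k (⟨4,4,4⟩:48 and its descendants, laser-method outputs) has non-unimodular or
non-affine-support legs; no stabilizer scheme with fewer than 7^k terms is known at any k.)
[arXiv:1612.01527, arXiv:2506.13242, BravyiSmithSmolin2016, AaronsonGottesman2004, Blaser2013]
#2 StabBeatsStrassen (crux) — the stabilizer model is not rigid: for some k the tensor ⟨2^k,2^k,2^k⟩
has a stabilizer scheme with fewer than 7^k terms (equivalently ω_stab < log₂ 7). NECESSARY for
OmegaStabTwo and the first bit of information about the model; its negation — Strassen recursion is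
optimal among Clifford/stabilizer schemes at every scale, χ₃(⟨2^k⟩) = 7^k — closes the route with a
rigidity theorem worth having. Cheapest instances: k = 2 (StabFourByFour48), k = 3 (⟨8,8,8⟩: is
there a stabilizer scheme with ≤ 342 terms, e.g. a stabilizer isotope of ⟨2,2,2:7⟩⊠⟨4,4,4:48⟩ =
336?), or a genuinely new Clifford-orbit design (card item (i): one seed triple, a subgroup G of
C_k³ ∩ isotropies, Σ_g χ(g) g·seed = ⟨2^k⟩ with |G| < 7^k). [difficulty: L] (why it might fail:
Rigidity is possible: unit-modulus amplitudes on affine F₂-supports may force χ₃(⟨2^k⟩) = 7^k for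
all k; the only known sub-7^k schemes at n = 2^k come from ⟨4,4,4⟩:48, whose seeds carry 1±i entries
and whose rational point has 368 non-±1 entries (arXiv:2506.13242 p10).) [arXiv:2506.13242,
arXiv:2506.13131, doi:10.1038/s41586-022-05172-4, arXiv:1612.01527, Strassen1969]
#3 StabFourByFour48 (crux) — χ₃(⟨4,4,4⟩) ≤ 48: a 48-term stabilizer scheme for 4 × 4 matrices
(4-qubit legs; 36720 stabilizer rays per leg, Schmidt rank across the row|column cut ∈ {1,2,4}).
Card item (iii). Cheapest attack: the ORBIT TEST — does the isotropy orbit (GL₄³-sandwiching, de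
Groote) of the AlphaEvolve/DPS decomposition ⟨4×4×4:48⟩ = ½Σ_(g∈G) g·τ₄ + Σ_(g∈G) g·τ₁ (G =
(C2×D4)⋊C2 of order 32; types 16·[2,2,2] + 32·[1,1,1], so all leg ranks are powers of 2 — the
necessary Schmidt-rank condition passes) contain a point with all 144 legs stabilizer? If not,
SAT/ILP over the finite dictionary with Clifford × isotropy symmetry breaking. Implies
StabBeatsStrassen (log₄ 48 = 2.7925 < log₂ 7). [difficulty: M] (why it might fail: The rank-48
isotropy orbit may contain no all-stabilizer point (seed τ1 has a leg with phase pattern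
(1,−i,−i,−i), not stabilizer; one isotropy must repair all 144 legs at once), 48 may be unattainable
in the model at all, and F₂'s 47 does not lift to characteristic 0.) [arXiv:2506.13242,
arXiv:2506.13131, arXiv:2212.01175, doi:10.1016/0304-3975(78)90045-2, AaronsonGottesman2004]
#4 StabilizerSufficiency (crux) — asymptotic stabilizer sufficiency ω_stab = ω: for every ε > 0 some
⟨2^k⟩ (k ≥ 1) has a stabilizer scheme with at most 2^((ω+ε)k) terms, ω = the tree's `omega ℂ`. The
structural half of the thesis (OmegaStabTwo ⟺ MatrixMultiplication ∧ StabilizerSufficiency):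
rank-near-optimal algorithms can be chosen magic-free. Two-sided and staffable on the NEGATIVE side:
ω_stab > ω ("non-stabilizerness is an asymptotic resource for fast matrix multiplication") would be
the first coefficient-structure separation for ⟨n,n,n⟩ and refutes the target (ω ≥ 2). Tools for the
negative side: coefficients w.l.o.g. in ℚ(i) relative to the unnormalised {0,±1,±i} legs (finite
dictionary ⇒ linear algebra over ℚ(i)), reduction mod (1+i) to affine-box identities over F₂,
PSV-type quadratic-phase correlation across the tripartite cut. [deps: StabBeatsStrassen]
[difficulty: open-problem] (why it might fail: Near-optimal schemes may need non-stabilizer legs at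
every scale with a uniform exponent loss: de-bordered laser schemes carry binomial/Vandermonde
weights, and expanding tensor powers of a non-stabilizer leg into stabilizer states costs
exponentially (PSV, Lovitz–Steffan): then ω_stab > ω.) [PelegShpilkaVolk2022, LovitzSteffan2022,
BravyiGosset2016, arXiv:2506.13242, Blaser2013]
#5 StabSeparation (crux) — the model bites at some finite scale: there is k such that EVERY
stabilizer scheme of ⟨2^k,2^k,2^k⟩ has more than R(⟨2^k,2^k,2^k⟩) terms (χ₃ > R: no rank-optimal
algorithm for 2^k × 2^k matrices is a stabilizer scheme). NEGATIVE-side milestone, staffed for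
refuters / lower-bounders; at k = 2 it reads "R(⟨4,4,4⟩) ≤ 48 (a Lean certificate from the published
rational scheme, valuable to the tree in itself) and χ₃(⟨4,4,4⟩) ≥ 49 (symmetry-reduced exhaustive
search)". True at no k yet; false at k = 1 (R = χ₃ = 7). Logically independent of OmegaStabTwo
(finite-scale separation can coexist with ω_stab = 2) but it calibrates StabilizerSufficiency and is
where a lower-bound technique for χ₃ must first show itself. [deps: StabFourByFour48] [difficulty:
L] (why it might fail: May be false at every scale (k = 1: all optimal 2×2 schemes are Strassen
isotopes, de Groote 1978, and Strassen is stabilizer); and proving χ₃ > R needs a lower-bound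
argument that sees discreteness — none exists; even k = 2 is an exhaustive search over 36720³ leg
triples modulo symmetry.) [doi:10.1016/0304-3975(78)90045-2, arXiv:2506.13242, arXiv:1408.6273,
PelegShpilkaVolk2022, LandsbergMichalek2018]
#9 StrassenStabilizer (support) — χ₃(⟨2,2,2⟩) ≤ 7 — Strassen's seven products form a stabilizer
scheme: all 21 legs, normalised, are 2-qubit stabilizer states ((|00⟩+|11⟩)/√2 = CNOT·(H⊗1)|00⟩,
(|10⟩−|00⟩)/√2, basis states, …; scalars go into c_i). The card's headline observation,
kernel-checkable with the tree's Clifford words (CliffordSimulator.lean: a T-free word prepares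
√2^#H times a stabilizer state). Base case of StrassenPowerFrame. [difficulty: provable-now]
[Strassen1969, AaronsonGottesman2004, arXiv:1708.09398]
#9 StabKronecker (support) — the model is Kronecker-closed: stabilizer schemes of ⟨2^k⟩ with r terms
and of ⟨2^l⟩ with s terms give one of ⟨2^(k+l)⟩ with r·s terms (⟨2^k⟩ ⊠ ⟨2^l⟩ ≅ ⟨2^(k+l)⟩ along bit
concatenation, as in Theorems/AsymptoticSpectrumKronecker; tensor products of stabilizer states are
stabilizer — the tree's tensorVec closure behind stabilizerRank_tensorVec_le — and the interleaving
of row/column registers is a wire permutation, i.e. Clifford). Gives Fekete's lemma for ω_stab and,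
with StrassenStabilizer, χ₃(⟨2^k⟩) ≤ 7^k. [difficulty: M] [Blaser2013,
BurgisserClausenShokrollahi1997, AaronsonGottesman2004, BravyiSmithSmolin2016]
#9 StrassenPowerFrame (support) — the upper frame ω_stab ≤ log₂ 7: for every k, ⟨2^k,2^k,2^k⟩ has a
stabilizer scheme with 7^k terms (induction from StrassenStabilizer and StabKronecker; k = 0: one
term with 0-qubit legs = zeroState 0). Calibrates StabBeatsStrassen (which asks for strictly fewer).
[difficulty: provable-now] [Strassen1969, Blaser2013]

TWO-LAYER PLAN. Foreseen glued splits (none filed now; k ≤ 3, depth 1): OmegaStabTwo ⇐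
CliffordOrbitDesignFamily → OrbitSumCriterion → OmegaStabTwo (the
card's mechanism (i): a family of seed triples + subgroups G_k ≤ C_k³ ∩ Iso(⟨2^k⟩) with |G_k|·#seeds
≤ 2^((2+o(1))k), and a character/moment
criterion for Σ_g χ(g) g·seed = ⟨2^k⟩ à la Grochow–Moore), opened only after StabBeatsStrassen
closes positively; StabBeatsStrassen ⇐
(k = 2 instance = StabFourByFour48) or (k = 3 instance: χ₃(⟨8,8,8⟩) ≤ 342) by scale; StabSeparation
⇐ RankFourCertificate (R(⟨4,4,4⟩) ≤ 48 in
Lean from the rational scheme) → StabFourIs49 (χ₃(⟨4,4,4⟩) ≥ 49) → StabSeparation.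

KILL CRITERIA. ¬StabBeatsStrassen proved (every stabilizer scheme of every ⟨2^k⟩ has ≥ 7^k terms) ⇒
ω_stab = log₂ 7 > 2 ⇒ the target is false: close
`refuted:StabBeatsStrassen` (the rigidity theorem is the tombstone). ¬OmegaStabTwo directly (∃δ > 0:
χ₃(⟨2^k⟩) ≥ 2^((2+δ)k) for all k ≥ 1), or
¬StabilizerSufficiency (ω_stab > ω; since ω ≥ 2 this refutes the target too): close refuted. NOT
kills: StabSeparation proved (finite-scale
separation is compatible with ω_stab = 2; it re-ranks StabilizerSufficiency up as the live
question); StabFourByFour48 refuted (drop it as not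
load-bearing and file the k = 3 instance; two consecutive scale refutations ⇒ pivot the route to its
negative side: thesis ω_stab > ω as a
structural theorem, or close exhausted). MatrixMultiplication proved elsewhere ⇒ close superseded
(StabilizerSufficiency survives as a card).

NOT DECOMPOSED YET. The Clifford-orbit design mechanism itself (seeds, subgroups of Sp(4k, F₂)-type
size, orbit-sum criterion) — layer-2 children of the target
once StabBeatsStrassen says the model moves at all; the lower-bound technology for χ₃
(ℚ(i)-rationality of coefficients, reduction mod (1+i) to
signed affine-box identities over F₂, quadratic-phase correlation bounds across the cut) — children
of StabSeparation / the negations once a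
first lemma exists; the odd-prime qudit variant ω_stab^(p) (n = p^k, Heisenberg–Weyl/Clifford over
F_p, only a 2-design) and the real sub-model
ω_stab,ℝ ≥ ω_(0,±1) (link to card integral-exponent-signed-boxes) — deliberately not filed; the
normal-form characterisation of
`stabilizerStates` (Dehaene–De Moor) — requested as a Literature fact, not an item; ε/δ bookkeeping
of the assembly — routine.

CHEAPEST FALSIFIER. The k = 2 ORBIT TEST (minutes of computer algebra, not run here — one-shot
planning unit without a compute lease): load the DPS rational
⟨4×4×4:48⟩ (PLinOpt data/4x4x4_48_rational_{L,R,P}.sms, arXiv:2506.13242 App. A) or AlphaEvolve's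
complex point; necessary conditions
first — after an isotropy (X,Y,Z) ↦ (PXQ⁻¹, QYR⁻¹, PZR⁻¹) every one of the 144 legs must have
affine-subspace support (size 1, 2, 4, 8 or 16
under SOME bijection [4] ≅ F₂² per index — 24³ relabellings; general isotropies change supports, so
this is only the first sieve) and constant modulus; then the phase test
(i^linear · (−1)^quadratic). FOUND ⇒ StabFourByFour48 and StabBeatsStrassen are settled positively
at once (certify in Lean with Clifford words);
NOT FOUND ⇒ nothing dies, but it is the first evidence that the model bites and it re-ranks
StabSeparation up. The killing computation proper —
χ₃(⟨4,4,4⟩) = 49 by symmetry-reduced exhaustive search (36720 rays per leg, Clifford³ × S₃ symmetry)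
— is far costlier and is StabSeparation's
k = 2 instance; a literature kill would be a published proof that optimal 2^k × 2^k schemes need
non-unimodular coefficients (none found).

NUMBERS. R(⟨2,2,2⟩) = χ₃(⟨2,2,2⟩) = 7 (Strassen1969; optimality Winograd 1971 / Hopcroft–Kerr; all
7-term schemes one isotropy orbit,
doi:10.1016/0304-3975(78)90045-2). ⟨4,4,4⟩: 29 ≤ bR ≤ R ≤ 48 over ℂ and ℚ (LandsbergMichalek2018:
bR(⟨n,n,n⟩) ≥ 2n² − log₂ n − 1; arXiv:2506.13131,
arXiv:2506.13242), 47 over F₂ only (doi:10.1038/s41586-022-05172-4, not liftable: arXiv:2212.01175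
§5), χ₃(⟨4,4,4⟩) ∈ [R, 49]. Exponents:
log₂ 7 = 2.8074 (= current upper bound on ω_stab), log₄ 48 = 2.7925, log₄ 47 = 2.7773, ω < 2.3714
(laser method), target 2. Stabilizer
counts |Stab_m| = 2^m ∏_(j≤m)(2^j+1): 6, 60, 1080, 36720 for m = 1..4 (legs of ⟨2^k⟩ have m = 2k);
|C_m / U(1)| = 2^(m²+2m) ∏_(j≤m)(4^j − 1)
(m = 2: 11520). AlphaEvolve ⟨4×4×4:48⟩: two seeds, isotropy subgroup (C2×D4)⋊C2 of order 32, type 16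
X²Y²Z² + 32 XYZ (arXiv:2506.13242 §3.2);
its rational point has 400/240/320 non-zeros of which 64/0/304 are not ±1 (ibid. p. 10). Items at
open: 9 (1 target, 4 cruxes, 3 support,
1 assembly).

DEFINITION REQUESTS. (1) `stabTensorRank k` (χ₃(⟨2^k⟩): the least r admitting the stabilizer scheme
written inline in every item) and `omegaStab := ⨅_(k≥1)
log₂(stabTensorRank k)/k` — new objects for this problem, topic
Summits/MatrixMultiplication/MatrixMultiplication/Theorems; would shrink every
statement to one line of prose. (2) Literature fact (trunk
Literature/Computability/QuantumComplexity): the Dehaene–De Moor / Van den Nest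
normal form `ψ ∈ stabilizerStates n ↔ ψ = ω^j 2^(−d/2) · 1_A · i^ℓ · (−1)^Q` (A affine subspace of
F₂^n of dimension d, ℓ linear, Q quadratic,
ω = e^(iπ/4)) — arXiv:quant-ph/0304125 Thm 1–2, arXiv:0811.0898 §3; the tree's
CliffordGaussSums.lean cites but does not state it; it is what
turns "χ₃ ≤ r" into a finite search and what provers of StabFourByFour48 / refuters of
StabSeparation enumerate. (3) No new bib keys could be
added this session (arXiv/OpenAlex/S2 APIs rate-limited): arXiv ids are used as source pointers.

Novelty: Searches (2026-08-15): `lit galaxy search "stabilizer rank" --star all` (11 rows: BSS/BBCCGH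
simulation papers, Lovitz project description,
Labib thesis — none touches matrix multiplication); `lit galaxy search "Strassen stabilizer states"
--star pdf` (0); `lit galaxy search "matrix
multiplication tensor Clifford group" --star pdf` (0); `lit galaxy search --mode intelligent "Is
Strassen's algorithm a sum of products of
stabilizer states; stabilizer tensor rank of the matrix multiplication tensor; Clifford symmetry of
bilinear algorithms" --star pdf` (12:
Briët–Christandl–Leigh–Shpilka–Zuiddam ITCS 2024 discreteness of asymptotic tensor ranks,
Landsberg's Trieste survey, Lovitz — no stabilizer
reading of ⟨n,n,n⟩); `lit frontier MatrixMultiplication --since 2022` (30 rows; nearest: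
arXiv:2602.11041 structure in tensor decompositions,
arXiv:2606.13408 catalog of fast MM algorithms, arXiv:2602.13171 complex-to-rational,
arXiv:2601.09477 Walsh–Hadamard compressed MM — none on
stabilizer/Clifford structure); `lit bridges MatrixMultiplication --cross QuantumAdvantage` (30
rows, all generic complexity texts; no paper
joins the MM roots to the stabilizer-rank roots); `lit read arxiv:2506.13242 --grep` (held now:
isotropy-orbit structure of ⟨4×4×4:48⟩, §3);
`lean search stabilizerStates` (tree: StabilizerRank.lean, CliffordGaussSums.lean — reused); the
local `lit search` index and the
arXiv/OpenAlex/S2 cascade were unavailable (connection reset / HTTP 429) — the card's refuter audit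
(2  [refs: 2602.11041, 2606.13408, 2602.13171, 2601.09477, 2506.13242, 1708.09398, 1612.01527, 0805.2592, 1003.3059, arxiv:2506.13242, BravyiSmithSmolin2016, PelegShpilkaVolk2022, LovitzSteffan2022]

Barriers (technique_class: stabilizer-rank, clifford-orbit-design, restricted-model): - technique_class: stabilizer-rank, clifford-orbit-design, restricted-model
- Literature.Barriers.MatrixMultiplication.InfimumNotMinimumBarrier: applies verbatim to every
single stabilizer scheme (one scheme for ⟨2^k⟩ certifies only ω ≤ log_(2^k) r > 2); evaded by
construction — OmegaStabTwo is a family (∀ε ∃k), and the finite cruxes StabBeatsStrassen /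
StabFourByFour48 are milestones about the model, never certificates of ω = 2.
- Literature.Barriers.MatrixMultiplication.LinearRankMethodBarrier: bites on the negative side only
when a χ₃ lower bound is routed through (border) rank (determinantal methods are capped linearly in
the format 4^k); StabSeparation / ¬StabilizerSufficiency ask for MODEL-SPECIFIC bounds (finite
dictionary ⇒ coefficients in ℚ(i), reduction mod (1+i) to affine-box identities over F₂,
symmetry-reduced enumeration at k = 2) outside the technique class — conceded: no such technique
exists yet beyond enumeration; the bet is that discreteness is usable.
- Literature.Barriers.MatrixMultiplication.TricoloredSumFreeBarrier: the stabilizer-looking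
algorithms that come from STPP constructions in F₂^m through the Hadamard (Clifford) transform and
inequality (1.1) are barred (bounded exponent 2, BCCGNSU Thm B); OmegaStabTwo must use stabilizer
schemes not of abelian-2-group STPP origin — Strassen's own scheme is of that other kind (entangled
Bell-pair legs across the row/column registers; it is not known to arise from a TPP/STPP
construction) — so the barrier shape

History (route lifecycle, newest last):
- 2026-08-15T16:18:50Z · rev 1: restated Assembly (stmt-MatrixMultiplication-3835) — route-repair (glue): deciding theorem `closes : OmegaStabTwo → MatrixMultiplication` proved sorry-free from proved Literature (HasStabilizerScheme/tensorRank_le (planner-rbadge-MatrixMultiplication-Stabilizer-9aa4b96b-g2-0)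
- 2026-08-16T04:11:22Z · AUTO-CRUX (backfill): OmegaStabTwo — hypotheses of the deciding theorem that nothing in the route derives are cruxes (operator:999:1085951)
- 2026-08-22T08:26:29Z · DORMANT — reconciler: no traction for 5.2 d (last activity statement-grounded at 2026-08-17T02:55:51Z); parked, not closed — `ledger route dormant route-MatrixMultiplicat (operator:999:1057963)

sub-problem: MatrixMultiplication · status: dormant · opened planner-plancard-MatrixMultiplication-MatrixM-fd4d46e3-0 2026-08-15T11:24:57Z · rev 4 · ledger route-MatrixMultiplication-StabilizerTensorRank
GENERATED by the gate from the ledger (D-0016/17). Provers cite these decls: `theorem foo : Summit.MatrixMultiplication.MatrixMultiplication.Theses.StabilizerTensorRank.<Decl> := …` in Summits/MatrixMultiplication/MatrixMultiplication/Theorems/<Name>.lean.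
-/

namespace Summit.MatrixMultiplication.MatrixMultiplication.Theses.StabilizerTensorRank

open scoped BigOperators Topology Manifold Classical MeasureTheory ProbabilityTheory Matrix InnerProductSpace ComplexConjugate ContinuousMap
open Filter Set Function TopologicalSpace MeasureTheory

attribute [summit_statement] _root_.MatrixMultiplication

/-- item stmt-MatrixMultiplication-3827 · crux (kind.auto-crux: conjecture-grade) · rank 0 · open · by planner
why it might fail: ω_stab may exceed 2 even if ω = 2: every known sub-Strassen scheme at n = 2^k (⟨4,4,4⟩:48 and its descendants, laser-method outputs) has non-unimodular or non-affine-support legs; no stabilizer scheme with fewer than 7^k terms is known at any k.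
sources: arXiv:1612.01527, arXiv:2506.13242, BravyiSmithSmolin2016, AaronsonGottesman2004, Blaser2013
[target] ω_stab = 2: for every ε > 0 there are k ≥ 1, r ≤ 2^((2+ε)k) and a stabilizer scheme of
⟨2^k,2^k,2^k⟩ with r terms (coefficients c_i ∈ ℂ, legs w_i,u_i,v_i : Fin 2^k × Fin 2^k → ℂ whose
bit-reindexings lie in stabilizerStates (k+k)). Card items (i)+(ii). -/
@[route_item "route-MatrixMultiplication-StabilizerTensorRank", crux]
def OmegaStabTwo : Prop :=
  ∀ ε : ℝ, 0 < ε → ∃ k : ℕ, 1 ≤ k ∧ ∃ r : ℕ, (r : ℝ) ≤ (2 : ℝ) ^ ((2 + ε) * k) ∧ ∃ (c : Fin r → ℂ) (w u v : Fin r → Fin (2 ^ k) × Fin (2 ^ k) → ℂ), (∀ i, (fun x : Fin (k + k) → Bool => w i (finFunctionFinEquiv (fun j : Fin k => finTwoEquiv.symm (x (Fin.castAdd k j))), finFunctionFinEquiv (fun j : Fin k => finTwoEquiv.symm (x (Fin.natAdd k j))))) ∈ Literature.Computability.QuantumComplexity.stabilizerStates (k + k) ∧ (fun x : Fin (k + k)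 → Bool => u i (finFunctionFinEquiv (fun j : Fin k => finTwoEquiv.symm (x (Fin.castAdd k j))), finFunctionFinEquiv (fun j : Fin k => finTwoEquiv.symm (x (Fin.natAdd k j))))) ∈ Literature.Computability.QuantumComplexity.stabilizerStates (k + k) ∧ (fun x : Fin (k + k) → Bool => v i (finFunctionFinEquiv (fun j : Fin k => finTwoEquiv.symm (x (Fin.castAdd k j))), finFunctionFinEquiv (fun j : Fin k => finTwoEquiv.symm (x (Fin.natAdd k j))))) ∈ Literature.Computability.QuantumComplexity.stabilizerStates (k + k)) ∧ Literature.Computability.AlgebraicComplexity.matMulTensor ℂ (2 ^ k) (2 ^ k) (2 ^ k) = ∑ i, c i • Literature.Computability.AlgebraicComplexity.triad (w i) (u i) (v i)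

/-- item stmt-MatrixMultiplication-3828 · crux · rank 2 · open · by planner
why it might fail: Rigidity is possible: unit-modulus amplitudes on affine F₂-supports may force χ₃(⟨2^k⟩) = 7^k for all k; the only known sub-7^k schemes at n = 2^k come from ⟨4,4,4⟩:48, whose seeds carry 1±i entries and whose rational point has 368 non-±1 entries (arXiv:2506.13242 p10).
sources: arXiv:2506.13242, arXiv:2506.13131, doi:10.1038/s41586-022-05172-4, arXiv:1612.01527, Strassen1969
[crux] the stabilizer model is not rigid: for some k the tensor ⟨2^k,2^k,2^k⟩ has a stabilizer
scheme with fewer than 7^k terms (equivalently ω_stab < log₂ 7). NECESSARY for OmegaStabTwo and the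
first bit of information about the model; its negation — Strassen recursion is optimal among
Clifford/stabilizer schemes at every scale, χ₃(⟨2^k⟩) = 7^k — closes the route with a rigidity
theorem worth having. Cheapest instances: k = 2 (StabFourByFour48), k = 3 (⟨8,8,8⟩: is there a
stabilizer scheme with ≤ 342 terms, e.g. a stabilizer isotope of ⟨2,2,2:7⟩⊠⟨4,4,4:48⟩ = 336?), or a
genuinely new Clifford-orbit design (card item (i): one seed triple, a subgroup G of C_k³ ∩
isotropies, Σ_g χ(g) g·seed = ⟨2^k⟩ with |G| < 7^k). [difficulty: L] -/
@[route_item "route-MatrixMultiplication-StabilizerTensorRank"]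
def StabBeatsStrassen : Prop :=
  ∃ k r : ℕ, r < 7 ^ k ∧ ∃ (c : Fin r → ℂ) (w u v : Fin r → Fin (2 ^ k) × Fin (2 ^ k) → ℂ), (∀ i, (fun x : Fin (k + k) → Bool => w i (finFunctionFinEquiv (fun j : Fin k => finTwoEquiv.symm (x (Fin.castAdd k j))), finFunctionFinEquiv (fun j : Fin k => finTwoEquiv.symm (x (Fin.natAdd k j))))) ∈ Literature.Computability.QuantumComplexity.stabilizerStates (k + k) ∧ (fun x : Fin (k + k) → Bool => u i (finFunctionFinEquiv (fun j : Fin k => finTwoEquiv.symm (x (Fin.castAdd k j))), finFunctionFinEquiv (fun j : Fin k => finTwoEquiv.symm (x (Fin.natAdd k j))))) ∈ Literature.Computability.QuantumComplexity.stabilizerStates (k + k) ∧ (fun x : Fin (k + k) → Bool => v i (finFunctionFinEquiv (fun j : Fin k => finTwoEquiv.symm (x (Fin.castAdd k j))), finFunctionFinEquiv (fun j : Fin k => finTwoEquiv.symm (x (Fin.natAdd k j))))) ∈ Literature.Computability.QuantumComplexity.stabilizerStates (k + k)) ∧ Literature.Computability.AlgebraicComplexity.matMulTensor ℂ (2 ^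 k) (2 ^ k) (2 ^ k) = ∑ i, c i • Literature.Computability.AlgebraicComplexity.triad (w i) (u i) (v i)

/-- item stmt-MatrixMultiplication-17943 · crux · rank 3 · open · by planner
why it might fail: Uniformity in c is the whole content: classically CW82 improves every algorithm only with gain → 0, via the τ-theorem on high tensor powers whose de-bordering is not known to keep legs stabilizer; one rigid plateau χ₃(⟨2^(mk)⟩) = χ₃(⟨2^k⟩)^m ∀m at a sub-Strassen scale kills every c > 0.
sources: CoppersmithWinograd1982, Blaser2013, BurgisserClausenShokrollahi1997, arXiv:2506.13242, Strassen1969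
[crux] STEP leaf of the typed decomposition OmegaStabTwo ⇐ StabBeatsStrassen ∧ StabDefectContraction
(crux-strategist BC2 redirect of the RESTATED deciding crux stmt-MatrixMultiplication-3827; glue
PROVED sorry-free — registered skeleton Cruxes/OmegaStabTwo/Lines/defect_contraction.lean,
OmegaStabTwo_of, and Theorems-ready evidence split.lean; to become a child of OmegaStabTwo when
'route edit --split OmegaStabTwo --into children.json' is applied — refused to this seat by the
final-cycle rule). UNIFORM SELF-IMPROVEMENT BELOW THE STRASSEN FRAME: a rate c > 0 such that every
stabilizer scheme of ⟨2^k,2^k,2^k⟩ (k ≥ 1) with r < 7^k terms, defect D := r/4^k ≥ 1 over the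
flattening bound, improves at the same or a Kronecker-multiple scale m·k to a stabilizer scheme of
⟨2^(mk)⟩ with r'·D^(c·m) ≤ r^m terms, i.e. beating the m-th Kronecker power of the input
(StabKronecker) by the fixed power c·m of its defect — Coppersmith–Winograd 1982 ('every algorithm
can be improved') made UNIFORM in the rate and kept INSIDE the stabilizer model; relative and
one-step: vacuous at k = 1 (χ₃(⟨2,2,2⟩) = 7), nothing without a sub-Strassen input, and with one the
glue iterates it (log-defect e = log(r/4^k)/ -/
@[route_item "route-MatrixMultiplication-StabilizerTensorRank"]
def StabDefectContraction : Prop :=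
  ∃ c : ℝ, 0 < c ∧ ∀ k r : ℕ, 1 ≤ k → r < 7 ^ k → Literature.Computability.AlgebraicComplexity.HasStabilizerScheme k r → ∃ m r' : ℕ, 1 ≤ m ∧ Literature.Computability.AlgebraicComplexity.HasStabilizerScheme (m * k) r' ∧ (r' : ℝ) * ((r : ℝ) / 4 ^ k) ^ (c * m) ≤ (r : ℝ) ^ m

/-- item stmt-MatrixMultiplication-3829 · crux · rank 3 · open · by planner
why it might fail: The rank-48 isotropy orbit may contain no all-stabilizer point (seed τ1 has a leg with phase pattern (1,−i,−i,−i), not stabilizer; one isotropy must repair all 144 legs at once), 48 may be unattainable in the model at all, and F₂'s 47 does not lift to characteristic 0.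
sources: arXiv:2506.13242, arXiv:2506.13131, arXiv:2212.01175, doi:10.1016/0304-3975(78)90045-2, AaronsonGottesman2004
[crux] χ₃(⟨4,4,4⟩) ≤ 48: a 48-term stabilizer scheme for 4 × 4 matrices (4-qubit legs; 36720
stabilizer rays per leg, Schmidt rank across the row|column cut ∈ {1,2,4}). Card item (iii).
Cheapest attack: the ORBIT TEST — does the isotropy orbit (GL₄³-sandwiching, de Groote) of the
AlphaEvolve/DPS decomposition ⟨4×4×4:48⟩ = ½Σ_(g∈G) g·τ₄ + Σ_(g∈G) g·τ₁ (G = (C2×D4)⋊C2 of order 32;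
types 16·[2,2,2] + 32·[1,1,1], so all leg ranks are powers of 2 — the necessary Schmidt-rank
condition passes) contain a point with all 144 legs stabilizer? If not, SAT/ILP over the finite
dictionary with Clifford × isotropy symmetry breaking. Implies StabBeatsStrassen (log₄ 48 = 2.7925 <
log₂ 7). [difficulty: M] -/
@[route_item "route-MatrixMultiplication-StabilizerTensorRank"]
def StabFourByFour48 : Prop :=
  ∃ (c : Fin 48 → ℂ) (w u v : Fin 48 → Fin 4 × Fin 4 → ℂ), (∀ i, (fun x : Fin 4 → Bool => w i (finFunctionFinEquiv (fun j : Fin 2 => finTwoEquiv.symm (x (Fin.castAdd 2 j))), finFunctionFinEquiv (fun j : Fin 2 => finTwoEquiv.symm (x (Fin.natAdd 2 j))))) ∈ Literature.Computability.QuantumComplexity.stabilizerStates 4 ∧ (fun x : Fin 4 → Bool => u i (finFunctionFinEquiv (fun j : Fin 2 => finTwoEquiv.symm (x (Fin.castAdd 2 j))), finFunctionFinEquiv (fun j : Fin 2 => finTwoEquiv.symm (x (Fin.natAdd 2 j))))) ∈ Literature.Computability.QuantumComplexity.stabilizerStates 4 ∧ (fun x : Fin 4 → Bool => v i (finFunctionFinEquiv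 (fun j : Fin 2 => finTwoEquiv.symm (x (Fin.castAdd 2 j))), finFunctionFinEquiv (fun j : Fin 2 => finTwoEquiv.symm (x (Fin.natAdd 2 j))))) ∈ Literature.Computability.QuantumComplexity.stabilizerStates 4) ∧ Literature.Computability.AlgebraicComplexity.matMulTensor ℂ 4 4 4 = ∑ i, c i • Literature.Computability.AlgebraicComplexity.triad (w i) (u i) (v i)

/-- item stmt-MatrixMultiplication-3830 · crux · rank 4 · open · by planner
why it might fail: Near-optimal schemes may need non-stabilizer legs at every scale with a uniform exponent loss: de-bordered laser schemes carry binomial/Vandermonde weights, and expanding tensor powers of a non-stabilizer leg into stabilizer states costs exponentially (PSV, Lovitz–Steffan): then ω_stab > ω.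
sources: PelegShpilkaVolk2022, LovitzSteffan2022, BravyiGosset2016, arXiv:2506.13242, Blaser2013
[crux] asymptotic stabilizer sufficiency ω_stab = ω: for every ε > 0 some ⟨2^k⟩ (k ≥ 1) has a
stabilizer scheme with at most 2^((ω+ε)k) terms, ω = the tree's `omega ℂ`. The structural half of
the thesis (OmegaStabTwo ⟺ MatrixMultiplication ∧ StabilizerSufficiency): rank-near-optimal
algorithms can be chosen magic-free. Two-sided and staffable on the NEGATIVE side: ω_stab > ω
("non-stabilizerness is an asymptotic resource for fast matrix multiplication") would be the first
coefficient-structure separation for ⟨n,n,n⟩ and refutes the target (ω ≥ 2). Tools for the negative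
side: coefficients w.l.o.g. in ℚ(i) relative to the unnormalised {0,±1,±i} legs (finite dictionary ⇒
linear algebra over ℚ(i)), reduction mod (1+i) to affine-box identities over F₂, PSV-type
quadratic-phase correlation across the tripartite cut. [deps: StabBeatsStrassen] [difficulty:
open-problem] -/
@[route_item "route-MatrixMultiplication-StabilizerTensorRank"]
def StabilizerSufficiency : Prop :=
  ∀ ε : ℝ, 0 < ε → ∃ k : ℕ, 1 ≤ k ∧ ∃ r : ℕ, (r : ℝ) ≤ (2 : ℝ) ^ ((Literature.Computability.AlgebraicComplexity.omega ℂ + ε) * k) ∧ ∃ (c : Fin r → ℂ) (w u v : Fin r → Fin (2 ^ k) × Fin (2 ^ k) → ℂ), (∀ i, (fun x : Fin (k + k) → Bool => w i (finFunctionFinEquiv (fun j : Fin k => finTwoEquiv.symm (x (Fin.castAdd k j))), finFunctionFinEquiv (fun j : Fin k => finTwoEquiv.symm (x (Fin.natAdd k j))))) ∈ Literature.Computability.QuantumComplexity.stabilizerStates (k + k) ∧ (fun x : Fin (k + k) → Bool => u i (finFunctionFinEquiv (fun j : Fin k => finTwoEquiv.symm (x (Fin.castAdd k j))), finFunctionFinEquiv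 (fun j : Fin k => finTwoEquiv.symm (x (Fin.natAdd k j))))) ∈ Literature.Computability.QuantumComplexity.stabilizerStates (k + k) ∧ (fun x : Fin (k + k) → Bool => v i (finFunctionFinEquiv (fun j : Fin k => finTwoEquiv.symm (x (Fin.castAdd k j))), finFunctionFinEquiv (fun j : Fin k => finTwoEquiv.symm (x (Fin.natAdd k j))))) ∈ Literature.Computability.QuantumComplexity.stabilizerStates (k + k)) ∧ Literature.Computability.AlgebraicComplexity.matMulTensor ℂ (2 ^ k) (2 ^ k) (2 ^ k) = ∑ i, c i • Literature.Computability.AlgebraicComplexity.triad (w i) (u i) (v i)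

/-- item stmt-MatrixMultiplication-3831 · crux · rank 5 · open · by planner
why it might fail: May be false at every scale (k = 1: all optimal 2×2 schemes are Strassen isotopes, de Groote 1978, and Strassen is stabilizer); and proving χ₃ > R needs a lower-bound argument that sees discreteness — none exists; even k = 2 is an exhaustive search over 36720³ leg triples modulo symmetry.
sources: doi:10.1016/0304-3975(78)90045-2, arXiv:2506.13242, arXiv:1408.6273, PelegShpilkaVolk2022, LandsbergMichalek2018
[crux] the model bites at some finite scale: there is k such that EVERY stabilizer scheme of
⟨2^k,2^k,2^k⟩ has more than R(⟨2^k,2^k,2^k⟩) terms (χ₃ > R: no rank-optimal algorithm for 2^k × 2^k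
matrices is a stabilizer scheme). NEGATIVE-side milestone, staffed for refuters / lower-bounders; at
k = 2 it reads "R(⟨4,4,4⟩) ≤ 48 (a Lean certificate from the published rational scheme, valuable to
the tree in itself) and χ₃(⟨4,4,4⟩) ≥ 49 (symmetry-reduced exhaustive search)". True at no k yet;
false at k = 1 (R = χ₃ = 7). Logically independent of OmegaStabTwo (finite-scale separation can
coexist with ω_stab = 2) but it calibrates StabilizerSufficiency and is where a lower-bound
technique for χ₃ must first show itself. [deps: StabFourByFour48] [difficulty: L] -/
@[route_item "route-MatrixMultiplication-StabilizerTensorRank"]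
def StabSeparation : Prop :=
  ∃ k : ℕ, ∀ r : ℕ, (∃ (c : Fin r → ℂ) (w u v : Fin r → Fin (2 ^ k) × Fin (2 ^ k) → ℂ), (∀ i, (fun x : Fin (k + k) → Bool => w i (finFunctionFinEquiv (fun j : Fin k => finTwoEquiv.symm (x (Fin.castAdd k j))), finFunctionFinEquiv (fun j : Fin k => finTwoEquiv.symm (x (Fin.natAdd k j))))) ∈ Literature.Computability.QuantumComplexity.stabilizerStates (k + k) ∧ (fun x : Fin (k + k) → Bool => u i (finFunctionFinEquiv (fun j : Fin k => finTwoEquiv.symm (x (Fin.castAdd k j))), finFunctionFinEquiv (fun j : Fin k => finTwoEquiv.symm (x (Fin.natAdd k j))))) ∈ Literature.Computability.QuantumComplexity.stabilizerStates (k + k) ∧ (fun x : Fin (k + k) → Bool => v i (finFunctionFinEquiv (fun j : Fin k => finTwoEquiv.symm (x (Fin.castAdd k j))), finFunctionFinEquiv (fun j : Fin k => finTwoEquiv.symm (x (Fin.natAdd k j))))) ∈ Literature.Computability.QuantumComplexity.stabilizerStates (k + k)) ∧ Literature.Computability.AlgebraicComplexity.matMulTensor ℂ (2 ^ k) (2 ^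 k) (2 ^ k) = ∑ i, c i • Literature.Computability.AlgebraicComplexity.triad (w i) (u i) (v i)) → Literature.Computability.AlgebraicComplexity.tensorRank (Literature.Computability.AlgebraicComplexity.matMulTensor ℂ (2 ^ k) (2 ^ k) (2 ^ k)) < r

/-- item stmt-MatrixMultiplication-18373 · support · rank 9 · open · by planner
[support · glue of the decomposition of the deciding crux] StabBeatsStrassen → StabDefectContraction
→ OmegaStabTwo: the seed (some scale beats the Strassen frame inside the stabilizer model) and the
step (uniform defect contraction below the frame) give ω_stab = 2 — iterate the step from the seed;
the scale multiplies, sub-Strassen-ness is preserved (r' ≤ r^m < 7^(mk)), the normalised log-defect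
e = log(r/4^k)/k contracts e' ≤ (1−c)e, so e_j ≤ (1−c)^j e₀ → 0, and e ≤ ε·log 2 is r ≤ 2^((2+ε)k).
PROVED sorry-free by the crux-strategist (evidence split.lean on stmt-MatrixMultiplication-3827:
`theorem omegaStabTwo_of_stabBeatsStrassen_of_defectContraction (hQ : StabBeatsStrassen) (hP :
StabDefectContraction) : OmegaStabTwo`, ~230 lines, axioms propext/Classical.choice/Quot.sound; also
kernel-checked in the registered skeleton Cruxes/OmegaStabTwo/Lines/defect_contraction.lean as
`omegaStabTwo_glue`). A prover lands it verbatim as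
Theorems/StabilizerTensorRankOmegaStabTwoSplit.lean; it is the `--glue-by` theorem for the pending
`route edit --split OmegaStabTwo --into children.json`. [difficulty: provable-now] Sources:
CoppersmithWinograd1982 (the classical, non-uniform self-improvement) -/
@[route_item "route-MatrixMultiplication-StabilizerTensorRank"]
def OmegaStabTwoGlue : Prop :=
  StabBeatsStrassen → StabDefectContraction → OmegaStabTwo

/-- item stmt-MatrixMultiplication-3832 · support · rank 9 · closed · proved by Summit.MatrixMultiplication.MatrixMultiplication.Theorems.strassenStabilizer_proof @ 02883de4a53b (prover) · by planner
sources: Strassen1969, AaronsonGottesman2004, arXiv:1708.09398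
[support] χ₃(⟨2,2,2⟩) ≤ 7 — Strassen's seven products form a stabilizer scheme: all 21 legs,
normalised, are 2-qubit stabilizer states ((|00⟩+|11⟩)/√2 = CNOT·(H⊗1)|00⟩, (|10⟩−|00⟩)/√2, basis
states, …; scalars go into c_i). The card's headline observation, kernel-checkable with the tree's
Clifford words (CliffordSimulator.lean: a T-free word prepares √2^#H times a stabilizer state). Base
case of StrassenPowerFrame. [difficulty: provable-now] -/
@[route_item "route-MatrixMultiplication-StabilizerTensorRank"]
def StrassenStabilizer : Prop :=
  ∃ (c : Fin 7 → ℂ) (w u v : Fin 7 → Fin (2 ^ 1) × Fin (2 ^ 1) → ℂ), (∀ i, (fun x : Fin (1 + 1) → Bool => w i (finFunctionFinEquiv (fun j : Fin 1 => finTwoEquiv.symm (x (Fin.castAdd 1 j))), finFunctionFinEquiv (fun j : Fin 1 => finTwoEquiv.symm (x (Fin.natAdd 1 j))))) ∈ Literature.Computability.QuantumComplexity.stabilizerStates (1 + 1) ∧ (fun x : Fin (1 + 1) → Bool => u i (finFunctionFinEquiv (fun j : Fin 1 => finTwoEquiv.symm (x (Fin.castAdd 1 j))), finFunctionFinEquiv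 (fun j : Fin 1 => finTwoEquiv.symm (x (Fin.natAdd 1 j))))) ∈ Literature.Computability.QuantumComplexity.stabilizerStates (1 + 1) ∧ (fun x : Fin (1 + 1) → Bool => v i (finFunctionFinEquiv (fun j : Fin 1 => finTwoEquiv.symm (x (Fin.castAdd 1 j))), finFunctionFinEquiv (fun j : Fin 1 => finTwoEquiv.symm (x (Fin.natAdd 1 j))))) ∈ Literature.Computability.QuantumComplexity.stabilizerStates (1 + 1)) ∧ Literature.Computability.AlgebraicComplexity.matMulTensor ℂ (2 ^ 1) (2 ^ 1) (2 ^ 1) = ∑ i, c i • Literature.Computability.AlgebraicComplexity.triad (w i) (u i) (v i)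

/-- item stmt-MatrixMultiplication-3833 · support · rank 9 · closed · proved by Summit.MatrixMultiplication.MatrixMultiplication.Theorems.stabKronecker_proof @ 2cd57b0dd9db (prover) · by planner
sources: Blaser2013, BurgisserClausenShokrollahi1997, AaronsonGottesman2004, BravyiSmithSmolin2016
[support] the model is Kronecker-closed: stabilizer schemes of ⟨2^k⟩ with r terms and of ⟨2^l⟩ with
s terms give one of ⟨2^(k+l)⟩ with r·s terms (⟨2^k⟩ ⊠ ⟨2^l⟩ ≅ ⟨2^(k+l)⟩ along bit concatenation, as
in Theorems/AsymptoticSpectrumKronecker; tensor products of stabilizer states are stabilizer — the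
tree's tensorVec closure behind stabilizerRank_tensorVec_le — and the interleaving of row/column
registers is a wire permutation, i.e. Clifford). Gives Fekete's lemma for ω_stab and, with
StrassenStabilizer, χ₃(⟨2^k⟩) ≤ 7^k. [difficulty: M] -/
@[route_item "route-MatrixMultiplication-StabilizerTensorRank"]
def StabKronecker : Prop :=
  ∀ k l r s : ℕ, (∃ (c : Fin r → ℂ) (w u v : Fin r → Fin (2 ^ k) × Fin (2 ^ k) → ℂ), (∀ i, (fun x : Fin (k + k) → Bool => w i (finFunctionFinEquiv (fun j : Fin k => finTwoEquiv.symm (x (Fin.castAdd k j))), finFunctionFinEquiv (fun j : Fin k => finTwoEquiv.symm (x (Fin.natAdd k j))))) ∈ Literature.Computability.QuantumComplexity.stabilizerStates (k + k) ∧ (fun x : Fin (k + k) → Bool => u i (finFunctionFinEquiv (fun j : Fin k => finTwoEquiv.symm (x (Fin.castAdd k j))), finFunctionFinEquiv (fun j : Fin k => finTwoEquiv.symm (x (Fin.natAdd k j))))) ∈ Literature.Computability.QuantumComplexity.stabilizerStates (k + k) ∧ (fun x : Fin (k + k) → Bool => v i (finFunctionFinEquiv (fun j : Fin k => finTwoEquiv.symm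 (x (Fin.castAdd k j))), finFunctionFinEquiv (fun j : Fin k => finTwoEquiv.symm (x (Fin.natAdd k j))))) ∈ Literature.Computability.QuantumComplexity.stabilizerStates (k + k)) ∧ Literature.Computability.AlgebraicComplexity.matMulTensor ℂ (2 ^ k) (2 ^ k) (2 ^ k) = ∑ i, c i • Literature.Computability.AlgebraicComplexity.triad (w i) (u i) (v i)) → (∃ (c : Fin s → ℂ) (w u v : Fin s → Fin (2 ^ l) × Fin (2 ^ l) → ℂ), (∀ i, (fun x : Fin (l + l) → Bool => w i (finFunctionFinEquiv (fun j : Fin l => finTwoEquiv.symm (x (Fin.castAdd l j))), finFunctionFinEquiv (fun j : Fin l => finTwoEquiv.symm (x (Fin.natAdd l j))))) ∈ Literature.Computability.QuantumComplexity.stabilizerStates (l + l) ∧ (fun x : Fin (l + l) → Bool => u i (finFunctionFinEquiv (fun j : Fin l => finTwoEquiv.symm (x (Fin.castAdd l j))), finFunctionFinEquiv (fun j : Fin l => finTwoEquiv.symm (x (Fin.natAdd l j))))) ∈ Literature.Computability.QuantumComplexity.stabilizerStates (l + l) ∧ (fun x : Fin (l + l) → Bool => v i (finFunctionFinEquiv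 (fun j : Fin l => finTwoEquiv.symm (x (Fin.castAdd l j))), finFunctionFinEquiv (fun j : Fin l => finTwoEquiv.symm (x (Fin.natAdd l j))))) ∈ Literature.Computability.QuantumComplexity.stabilizerStates (l + l)) ∧ Literature.Computability.AlgebraicComplexity.matMulTensor ℂ (2 ^ l) (2 ^ l) (2 ^ l) = ∑ i, c i • Literature.Computability.AlgebraicComplexity.triad (w i) (u i) (v i)) → ∃ (c : Fin (r * s) → ℂ) (w u v : Fin (r * s) → Fin (2 ^ (k + l)) × Fin (2 ^ (k + l)) → ℂ), (∀ i, (fun x : Fin ((k + l) + (k + l)) → Bool => w i (finFunctionFinEquiv (fun j : Fin ((k + l)) => finTwoEquiv.symm (x (Fin.castAdd ((k + l)) j))), finFunctionFinEquiv (fun j : Fin ((k + l)) => finTwoEquiv.symm (x (Fin.natAdd ((k + l)) j))))) ∈ Literature.Computability.QuantumComplexity.stabilizerStates ((k + l) + (k + l)) ∧ (fun x : Fin ((k + l) + (k + l)) → Bool => u i (finFunctionFinEquiv (fun j : Fin ((k + l)) => finTwoEquiv.symm (x (Fin.castAdd ((k + l)) j))), finFunctionFinEquiv (fun j : Fin ((k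 + l)) => finTwoEquiv.symm (x (Fin.natAdd ((k + l)) j))))) ∈ Literature.Computability.QuantumComplexity.stabilizerStates ((k + l) + (k + l)) ∧ (fun x : Fin ((k + l) + (k + l)) → Bool => v i (finFunctionFinEquiv (fun j : Fin ((k + l)) => finTwoEquiv.symm (x (Fin.castAdd ((k + l)) j))), finFunctionFinEquiv (fun j : Fin ((k + l)) => finTwoEquiv.symm (x (Fin.natAdd ((k + l)) j))))) ∈ Literature.Computability.QuantumComplexity.stabilizerStates ((k + l) + (k + l))) ∧ Literature.Computability.AlgebraicComplexity.matMulTensor ℂ (2 ^ (k + l)) (2 ^ (k + l)) (2 ^ (k + l)) = ∑ i, c i • Literature.Computability.AlgebraicComplexity.triad (w i) (u i) (v i)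

/-- item stmt-MatrixMultiplication-3834 · support · rank 9 · closed · proved by Summit.MatrixMultiplication.MatrixMultiplication.Theorems.strassenPowerFrame_proof @ 3461f34e8d74 (prover) · by planner
sources: Strassen1969, Blaser2013
[support] the upper frame ω_stab ≤ log₂ 7: for every k, ⟨2^k,2^k,2^k⟩ has a stabilizer scheme with
7^k terms (induction from StrassenStabilizer and StabKronecker; k = 0: one term with 0-qubit legs =
zeroState 0). Calibrates StabBeatsStrassen (which asks for strictly fewer). [difficulty:
provable-now] -/
@[route_item "route-MatrixMultiplication-StabilizerTensorRank"]
def StrassenPowerFrame : Prop :=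
  ∀ k : ℕ, ∃ (c : Fin (7 ^ k) → ℂ) (w u v : Fin (7 ^ k) → Fin (2 ^ k) × Fin (2 ^ k) → ℂ), (∀ i, (fun x : Fin (k + k) → Bool => w i (finFunctionFinEquiv (fun j : Fin k => finTwoEquiv.symm (x (Fin.castAdd k j))), finFunctionFinEquiv (fun j : Fin k => finTwoEquiv.symm (x (Fin.natAdd k j))))) ∈ Literature.Computability.QuantumComplexity.stabilizerStates (k + k) ∧ (fun x : Fin (k + k) → Bool => u i (finFunctionFinEquiv (fun j : Fin k => finTwoEquiv.symm (x (Fin.castAdd k j))), finFunctionFinEquiv (fun j : Fin k => finTwoEquiv.symm (x (Fin.natAdd k j))))) ∈ Literature.Computability.QuantumComplexity.stabilizerStates (k + k) ∧ (fun x : Fin (k + k) → Bool => v i (finFunctionFinEquiv (fun j : Fin k => finTwoEquiv.symm (x (Fin.castAdd k j))), finFunctionFinEquiv (fun j : Fin k => finTwoEquiv.symm (x (Fin.natAdd k j))))) ∈ Literature.Computability.QuantumComplexity.stabilizerStates (k + k)) ∧ Literature.Computability.AlgebraicComplexity.matMulTensor ℂ (2 ^ k) (2 ^ k) (2 ^ k)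 = ∑ i, c i • Literature.Computability.AlgebraicComplexity.triad (w i) (u i) (v i)

-- earlier Assembly (stmt-MatrixMultiplication-3835, replaced 2026-08-15T16:18:50Z -> stmt-MatrixMultiplication-10582): retired by None — (∀ ε : ℝ, 0 < ε → ∃ k : ℕ, 1 ≤ k ∧ ∃ r : ℕ, (r : ℝ) ≤ (2 : ℝ) ^ ((2 + ε) * k) ∧ ∃ (c : Fin r → ℂ) (w u v : Fin r → Fin (2 ^ k) × Fin (2 ^ k) → ℂ), (∀ i, (fun x : Fin (k + k) → Bool => w i (finFunctionFinEquiv (fun j : Fin k => finTwoEquiv.symm (x (Fin.castAdd k j))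
/-- item stmt-MatrixMultiplication-10582 · assembly · rank 1 · closed · proved by Summit.MatrixMultiplication.MatrixMultiplication.Theorems.stabilizerTensorRank_assembly_proof @ 7ac08aa6932c (prover) · by planner
sources: Blaser2013, BurgisserClausenShokrollahi1997
[assembly] OmegaStabTwo → MatrixMultiplication, the target BY NAME implies the summit (ω(ℂ) = 2);
proved verbatim by the route's deciding theorem `closes` (rank ≤ stabilizer-scheme size, Bläser Thm
5.9 interpolation ω ≤ log_(2^k) r ≤ 2+ε, ω ≥ 2 by flattening). Sources: Blaser2013 Thm 5.9,
BurgisserClausenShokrollahi1997 Prop. 15.5. -/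
@[route_item "route-MatrixMultiplication-StabilizerTensorRank"]
def Assembly : Prop :=
  OmegaStabTwo → MatrixMultiplication

/-! D-0027 §2.1 — DECIDING THEOREM (planner-authored via `route open/edit --closes-file`; by planner-rbadge-MatrixMultiplication-Stabilizer-9aa4b96b-g2-0 2026-08-15T16:18:50Z):
its hypotheses are this route's items and its conclusion the sub-problem Statement (glue_lint), and it elaborates with this file. -/

@[closes "route-MatrixMultiplication-StabilizerTensorRank"] theorem closes (hT : OmegaStabTwo) : _root_.MatrixMultiplication := by
  -- D-0027 §2.1 deciding theorem of route StabilizerTensorRank: the target `ω_stab = 2` alone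
  -- decides the summit `ω(ℂ) = 2`; every constant used below is PROVED Literature
  -- (StabilizerTensorRank.lean, TensorRankFactsProofs.lean, FlatteningBound.lean).
  rw [_root_.MatrixMultiplication_iff]
  refine le_antisymm ?_ (Literature.Computability.AlgebraicComplexity.omega_two_le ℂ)
  refine le_of_forall_pos_le_add fun ε hε => ?_
  obtain ⟨k, hk, r, hr, c, w, u, v, hleg, hsum⟩ := hT ε hε
  -- the stabilizer scheme is in particular a rank decomposition: R(⟨2^k⟩) ≤ χ₃(⟨2^k⟩) ≤ r
  have hS : Literature.Computability.AlgebraicComplexity.HasStabilizerScheme k r :=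
    ⟨c, w, u, v, hleg, hsum⟩
  have hR : Literature.Computability.AlgebraicComplexity.tensorRank
      (Literature.Computability.AlgebraicComplexity.matMulTensor ℂ (2 ^ k) (2 ^ k) (2 ^ k)) ≤ r :=
    (Literature.Computability.AlgebraicComplexity.tensorRank_le_stabTensorRank k).trans
      (Literature.Computability.AlgebraicComplexity.stabTensorRank_le_of_hasStabilizerScheme hS)
  -- N = 2^k ≥ 2 and r ≥ 1 (flattening bound (2^k)² ≤ R(⟨2^k⟩) ≤ r)
  have hN : 1 < 2 ^ k :=
    lt_of_lt_of_le (by norm_num : 1 < 2 ^ 1) (Nat.pow_le_pow_right (by norm_num) hk)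
  have hsq := Literature.Computability.AlgebraicComplexity.matMulTensor_sq_le_tensorRank ℂ (2 ^ k)
  have hpos : 0 < (2 ^ k) ^ 2 := by positivity
  have h0r : 0 < r := lt_of_lt_of_le hpos (hsq.trans hR)
  have hr1 : 1 ≤ r := Nat.succ_le_of_lt h0r
  -- Bläser 2013, Thm 5.9 (interpolation): log_{2^k} r is an admissible exponent, so ω ≤ log_{2^k} r
  have hmem :=
    Literature.Computability.AlgebraicComplexity.Blaser2013_logb_mem_admissibleExponents ℂ hN hr1 hR
  have hω : Literature.Computability.AlgebraicComplexity.omega ℂ ≤ Real.logb ((2 ^ k : ℕ) : ℝ) r :=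
    csInf_le (Literature.Computability.AlgebraicComplexity.admissibleExponents_bddBelow ℂ) hmem
  -- log_{2^k} r ≤ 2 + ε from r ≤ 2^((2+ε)k)
  have hkpos : (0 : ℝ) < k := Nat.cast_pos.mpr (by omega)
  have hlog2 : 0 < Real.log 2 := Real.log_pos one_lt_two
  have hr0 : (0 : ℝ) < r := Nat.cast_pos.mpr h0r
  have hbase : Real.log ((2 ^ k : ℕ) : ℝ) = k * Real.log 2 := by
    rw [Nat.cast_pow, Nat.cast_ofNat, Real.log_pow]
  have hlogr : Real.log (r : ℝ) ≤ (2 + ε) * k * Real.log 2 :=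
    calc Real.log (r : ℝ) ≤ Real.log ((2 : ℝ) ^ ((2 + ε) * k)) := Real.log_le_log hr0 hr
      _ = (2 + ε) * k * Real.log 2 := Real.log_rpow two_pos _
  have hlogb : Real.logb ((2 ^ k : ℕ) : ℝ) r ≤ 2 + ε := by
    rw [Real.logb, hbase, div_le_iff₀ (mul_pos hkpos hlog2)]
    calc Real.log (r : ℝ) ≤ (2 + ε) * k * Real.log 2 := hlogr
      _ = (2 + ε) * (k * Real.log 2) := by ring
  exact hω.trans hlogb

end Summit.MatrixMultiplication.MatrixMultiplication.Theses.StabilizerTensorRank
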